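import Summits.HodgeConjecture.HodgeConjecture.Theses.DeltaPeriodAudit
import Literature.NumberTheory.EllipticCurves.SchollBettiRealisation
import Literature.NumberTheory.EllipticCurves.NewformGaloisRep
import Literature.NumberTheory.EllipticCurves.NewformsRealCoefficients
import Literature.NumberTheory.EllipticCurves.PeriodRationalityProofs
import HarnessLib

/-!
# Crux `HodgeForcesNewformPeriodRatioIrrational` (stmt-HodgeConjecture-2365), line `birth` — stub C
# `stub_periodRatioSq_irrational_of_hodgeEndScalar`: NO EXTRA HODGE ENDOMORPHISMS ON `V_f` ⟹ THE CROSS-PARITY PERIOD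
# RATIO SQUARED IS IRRATIONAL (the Eichler–Shimura–Manin dictionary, route Lemma 1 on Scholl's realisation)

Route `HodgeConjecture/DeltaPeriodAudit`; registered skeleton
`Cruxes/HodgeForcesNewformPeriodRatioIrrational/Lines/birth.lean` (`HodgeForcesNewformPeriodRatioIrrational_of`: STUB A
Scholl's motive as a Betti–`ℓ`-adic system obeying Deligne's principle under HC (XL) → STUB B open image ⟹ rational scalar
commutant (Ribet/Momose) → STUB C). This file closes STUB C, for every Scholl Betti realisation `D` of a cusp form `f` with
`K_f = ℚ` which is real on the imaginary axis:

**Theorem** (`irrational_periodRatio_sq_of_hodgeEndScalar`). If every endomorphism of Hodge structures of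
`H^{k-1}(W(ℂ); ℚ)` compressed to `V_f = Π_f H^{k-1}` is a rational scalar, then for all critical `a, b` of opposite parity with
`s_a(f) s_b(f) ≠ 0` (`s_j(f) = ∫₀^∞ tʲ Re f(it) dt`), `(s_a/s_b)²` is irrational.
Proof (contrapositive). Let `φ_a, φ_b` be the rational period functionals (`D.period`: `φ_j(ω_f) = r_j(f) = i^{j+1} s_j`,
`φ_j ∘ F_∞ = (-1)ʲ φ_j`). Symmetrising `Π_f v ± F_∞ Π_f v` produces `e_a, e_b ∈ V_f` with `φ_a(e_a) = φ_b(e_b) = 1`,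
`φ_a(e_b) = φ_b(e_a) = 0` (opposite parities); `dim_ℚ V_f = 2` makes `{e_a, e_b}` a basis, so
`ω_f = α e_a + β e_b` in `V_f,ℂ` with `α = i^{a+1} s_a`, `β = i^{b+1} s_b`. If `(s_a/s_b)² = q ∈ ℚ` then
`α²/β² = (-1)^{a+b} q = -q`, and the rational endomorphism `A = (φ_a ∘ Π_f)(·) e_b − q (φ_b ∘ Π_f)(·) e_a` (matrix `(0 −q; 1 0)` on
`V_f` in the basis `e_a, e_b`, zero on `ker Π_f`) satisfies `A_ℂ ω_f = (α/β) ω_f`; since `F^p ∩ V_f,ℂ` is `V_f,ℂ`, `ℂ ω_f` or `0`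
(`F⁰ = ⊤`, `F¹ ∩ V_f = F^{k-1} ∩ V_f` of dimension `[K_f : ℚ] = 1`, `Fᵏ = 0`), `A` is an endomorphism of Hodge structures whose
compression maps `e_a ↦ e_b` — not a scalar.

§5 gives the stub in the registered spelling (file-local notation `compress` for the skeleton's compression).

HONEST STATUS. Nothing here is a case of the Hodge conjecture; STUB A (Scholl's motive under HC, XL) and STUB B (open image ⟹
scalar commutant) remain. No definition, no named fact, no sorry.
References: [DeningerScholl1991] Thm. 5.2 and Remark (2), 5.3; [Scholl1990] §1.2 Thm. 1.2.4; [PasolPopa2013] Prop. 5.11;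
[Manin1973] §1; [Shimura1977] §1.
-/

noncomputable section

-- every declaration of this problem lives in `Summit.HodgeConjecture.HodgeConjecture.…` (summit = sub-problem)
set_option linter.dupNamespace false

open scoped TensorProduct
open Literature.AlgebraicGeometry.Motives
open Literature.NumberTheory.EllipticCurves.ModularForms

namespace Summit.HodgeConjecture.HodgeConjecture.Theorems.HodgeForcesNewformPeriodRatioIrrational

/-! ## §1 Base-change plumbing over `ℚ ⊂ ℂ` -/

section BaseChange

variable {V : Type*} [AddCommGroup V] [Module ℚ V]

/-- `(φ ∘ g)_ℂ = φ_ℂ ∘ g_ℂ` for a functional `φ` and an endomorphism `g`. [folklore] -/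
theorem dual_baseChange_comp (φ : Module.Dual ℚ V) (g : V →ₗ[ℚ] V) :
    Module.Dual.baseChange ℂ (φ ∘ₗ g) = Module.Dual.baseChange ℂ φ ∘ₗ g.baseChange ℂ := by
  refine TensorProduct.AlgebraTensorModule.ext fun z v ↦ ?_
  simp [Module.Dual.baseChange_apply_tmul, LinearMap.baseChange_tmul]

/-- `(φ(·) e)_ℂ (x) = φ_ℂ(x) • (1 ⊗ e)`. [folklore] -/
theorem baseChange_smulRight_apply (φ : Module.Dual ℚ V) (e : V) (x : ℂ ⊗[ℚ] V) :
    (φ.smulRight e).baseChange ℂ x = (Module.Dual.baseChange ℂ φ x) • ((1 : ℂ) ⊗ₜ[ℚ] e) := by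
  induction x using TensorProduct.induction_on with
  | zero => simp
  | tmul z v =>
    rw [LinearMap.baseChange_tmul, LinearMap.smulRight_apply, Module.Dual.baseChange_apply_tmul,
      TensorProduct.smul_tmul', smul_eq_mul, mul_one, TensorProduct.tmul_smul, TensorProduct.smul_tmul',
      ← TensorProduct.smul_tmul']
  | add x y hx hy => rw [map_add, map_add, hx, hy, add_smul]

/-- `φ_ℂ (1 ⊗ v) = φ v`. [folklore] -/
theorem dual_baseChange_one_tmul (φ : Module.Dual ℚ V) (v : V) :
    Module.Dual.baseChange ℂ φ ((1 : ℂ) ⊗ₜ[ℚ] v) = ((φ v : ℚ) : ℂ) := by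
  rw [Module.Dual.baseChange_apply_tmul, Rat.smul_one_eq_cast]

end BaseChange

/-! ## §2 The realisation: elementary consequences of the fields -/

section Realisation

variable {N : ℕ} {k : ℤ} {f : CuspForm (CongruenceSubgroup.Gamma0 N) k} (D : SchollBettiRealisation f)

/-- `Π_f x = x` on `V_f = range Π_f`. [cite: DeningerScholl1991, Thm. 5.2] -/
theorem proj_apply_of_mem {x : bettiCohomology D.W (k - 1).toNat} (hx : x ∈ D.carrier) :
    D.proj.toLinearMap x = x := by
  obtain ⟨y, rfl⟩ := hx
  exact D.proj_proj y

/-- `F_∞` preserves `V_f` (`Π_f` commutes with `F_∞`). [cite: DeningerScholl1991, 5.3–5.4] -/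
theorem frobInfty_mem_carrier {x : bettiCohomology D.W (k - 1).toNat} (hx : x ∈ D.carrier) :
    frobInfty D.W (k - 1).toNat x ∈ D.carrier := by
  obtain ⟨y, rfl⟩ := hx
  have h := LinearMap.congr_fun D.proj_comp_frobInfty y
  simp only [LinearMap.comp_apply] at h
  exact ⟨_, h⟩

/-- **Symmetrisation**: from a rational functional `φ` of `F_∞`-parity `ε` (`ε² = 1`) which does not vanish on `V_f`, and a
functional `φ'` of the opposite parity, a vector `e ∈ V_f` with `φ e = 1`, `φ' e = 0`.
[cite: DeningerScholl1991, 5.2 Remark (2)] [cite: Manin1973, §1] -/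
theorem exists_mem_carrier_dual_eq_one_eq_zero {φ φ' : Module.Dual ℚ (bettiCohomology D.W (k - 1).toNat)} {ε : ℚ}
    (hε : ε * ε = 1) (hφ : φ ∘ₗ frobInfty D.W (k - 1).toNat = ε • φ)
    (hφ' : φ' ∘ₗ frobInfty D.W (k - 1).toNat = (-ε) • φ') (hne : φ ∘ₗ D.proj.toLinearMap ≠ 0) :
    ∃ e ∈ D.carrier, φ e = 1 ∧ φ' e = 0 := by
  -- a vector of `V_f` on which `φ` does not vanish
  obtain ⟨v, hv⟩ : ∃ v, φ (D.proj.toLinearMap v) ≠ 0 := by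
    by_contra h
    push Not at h
    exact hne (LinearMap.ext fun v ↦ by simpa using h v)
  set p := D.proj.toLinearMap v with hp
  set w := p + ε • frobInfty D.W (k - 1).toNat p with hw
  have hφF : ∀ y, φ (frobInfty D.W (k - 1).toNat y) = ε * φ y := fun y ↦ by
    simpa using LinearMap.congr_fun hφ y
  have hφ'F : ∀ y, φ' (frobInfty D.W (k - 1).toNat y) = -ε * φ' y := fun y ↦ by
    simpa using LinearMap.congr_fun hφ' y
  have hφw : φ w = 2 * φ p := by
    rw [hw, map_add, map_smul, hφF, smul_eq_mul, ← mul_assoc, hε, one_mul, two_mul]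
  have hφ'w : φ' w = 0 := by
    rw [hw, map_add, map_smul, hφ'F, smul_eq_mul, ← mul_assoc, mul_neg, hε]; ring
  have hwmem : w ∈ D.carrier :=
    D.carrier.add_mem (LinearMap.mem_range_self _ v)
      (D.carrier.smul_mem ε (frobInfty_mem_carrier D (LinearMap.mem_range_self _ v)))
  have hφw0 : φ w ≠ 0 := by rw [hφw]; exact mul_ne_zero two_ne_zero hv
  refine ⟨(φ w)⁻¹ • w, D.carrier.smul_mem _ hwmem, ?_, ?_⟩
  · rw [map_smul, smul_eq_mul, inv_mul_cancel₀ hφw0]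
  · rw [map_smul, hφ'w, smul_zero]

/-- For a rational newform (`K_f = ℚ`), **two vectors of `V_f` with a "dual" pair of functionals span `V_f`**:
`V_f = ℚ e_a ⊕ ℚ e_b` (`dim_ℚ V_f = 2`). [cite: DeningerScholl1991, Thm. 5.2] -/
theorem carrier_le_span_pair (hK : coeffField f = ⊥) {φa φb : Module.Dual ℚ (bettiCohomology D.W (k - 1).toNat)}
    {ea eb : bettiCohomology D.W (k - 1).toNat} (ha : ea ∈ D.carrier) (hb : eb ∈ D.carrier)
    (haa : φa ea = 1) (hab : φb ea = 0) (hba : φa eb = 0) (hbb : φb eb = 1) :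
    D.carrier ≤ Submodule.span ℚ {ea, eb} := by
  haveI : Module.Finite ℚ (bettiCohomology D.W (k - 1).toNat) := D.finite
  have hli : LinearIndependent ℚ ![ea, eb] := by
    refine LinearIndependent.pair_iff.2 fun s t hst ↦ ?_
    have h1 := congrArg φa hst
    have h2 := congrArg φb hst
    simp only [map_add, map_smul, haa, hab, hba, hbb, smul_eq_mul, mul_one, mul_zero, add_zero, zero_add,
      map_zero] at h1 h2
    exact ⟨h1, h2⟩
  have hle : Submodule.span ℚ {ea, eb} ≤ D.carrier := by
    rw [Submodule.span_le]
    rintro x (rfl | rfl)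
    · exact ha
    · exact hb
  have hrange : Set.range ![ea, eb] = {ea, eb} := by
    ext x
    simp only [Matrix.range_cons, Matrix.range_empty, Set.union_empty, Set.union_singleton, Set.mem_insert_iff,
      Set.mem_singleton_iff]
    tauto
  have hfin : Module.finrank ℚ ↥(Submodule.span ℚ {ea, eb}) = 2 := by
    rw [← hrange, finrank_span_eq_card hli, Fintype.card_fin]
  have heq : Submodule.span ℚ {ea, eb} = D.carrier :=
    Submodule.eq_of_le_of_finrank_eq hle (by rw [hfin, D.finrank_carrier_of_coeffField_eq_bot hK])
  rw [heq]

/-- **`Π_{f,ℂ}` lands in `ℂ e_a ⊕ ℂ e_b`** when `V_f ⊆ ℚ e_a + ℚ e_b`. [folklore] -/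
theorem proj_baseChange_mem_span_pair {ea eb : bettiCohomology D.W (k - 1).toNat}
    (hspan : D.carrier ≤ Submodule.span ℚ {ea, eb}) (y : ℂ ⊗[ℚ] bettiCohomology D.W (k - 1).toNat) :
    D.proj.toLinearMap.baseChange ℂ y ∈
      Submodule.span ℂ {((1 : ℂ) ⊗ₜ[ℚ] ea), ((1 : ℂ) ⊗ₜ[ℚ] eb)} := by
  induction y using TensorProduct.induction_on with
  | zero => rw [map_zero]; exact Submodule.zero_mem _
  | tmul z v =>
    rw [LinearMap.baseChange_tmul]
    have hv : D.proj.toLinearMap v ∈ Submodule.span ℚ {ea, eb} := hspan (LinearMap.mem_range_self _ v)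
    obtain ⟨s, t, hst⟩ := Submodule.mem_span_pair.1 hv
    rw [← hst, TensorProduct.tmul_add, TensorProduct.tmul_smul, TensorProduct.tmul_smul]
    refine Submodule.add_mem _ ?_ ?_
    · have h : s • (z ⊗ₜ[ℚ] ea) = ((s : ℂ) * z) • ((1 : ℂ) ⊗ₜ[ℚ] ea) := by
        rw [TensorProduct.smul_tmul', TensorProduct.smul_tmul', Rat.smul_def, smul_eq_mul, mul_one]
      rw [h]
      exact Submodule.smul_mem _ _ (Submodule.subset_span (Set.mem_insert _ _))
    · have h : t • (z ⊗ₜ[ℚ] eb) = ((t : ℂ) * z) • ((1 : ℂ) ⊗ₜ[ℚ] eb) := by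
        rw [TensorProduct.smul_tmul', TensorProduct.smul_tmul', Rat.smul_def, smul_eq_mul, mul_one]
      rw [h]
      exact Submodule.smul_mem _ _ (Submodule.subset_span (Set.mem_insert_of_mem _ (Set.mem_singleton _)))
  | add x y hx hy => rw [map_add]; exact Submodule.add_mem _ hx hy

/-- **`F^p ∩ V_{f,ℂ} = ℂ ω_f` for `1 ≤ p ≤ k - 1`** when `K_f = ℚ`: every class of `F^p` whose projection we take lands on the
Eichler–Shimura line (`F¹ ∩ V_f = F^{k-1} ∩ V_f` has dimension `[K_f : ℚ] = 1` and contains `ω_f ≠ 0`).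
[cite: DeningerScholl1991, 5.2 Remark (2)] -/
theorem exists_proj_baseChange_eq_smul_omega (hK : coeffField f = ⊥) {p : ℤ} (hp1 : 1 ≤ p)
    {x : ℂ ⊗[ℚ] bettiCohomology D.W (k - 1).toNat} (hx : x ∈ D.hodge.F p) :
    ∃ c : ℂ, D.proj.toLinearMap.baseChange ℂ x = c • D.omega := by
  -- `Π x ∈ F^p ∩ range Π ⊆ F¹ ∩ range Π = F^{k-1} ∩ range Π`
  have hPx : D.proj.toLinearMap.baseChange ℂ x ∈ D.hodge.F p := D.proj.map_F_le p ⟨x, hx, rfl⟩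
  have hmem : D.proj.toLinearMap.baseChange ℂ x ∈
      D.hodge.F (k - 1) ⊓ LinearMap.range (D.proj.toLinearMap.baseChange ℂ) := by
    rw [← D.F_one_inf_eq]
    exact ⟨D.hodge.antitone_F hp1 hPx, LinearMap.mem_range_self _ x⟩
  -- that intersection is the line `ℂ ω_f`
  have hfin : Module.finrank ℂ ↥(D.hodge.F (k - 1) ⊓ LinearMap.range (D.proj.toLinearMap.baseChange ℂ)) = 1 := by
    rw [D.finrank_F_inf_range, hK, IntermediateField.finrank_bot]
  have hω : (⟨D.omega, D.omega_mem_inf⟩ :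
      ↥(D.hodge.F (k - 1) ⊓ LinearMap.range (D.proj.toLinearMap.baseChange ℂ))) ≠ 0 := by
    intro h
    exact D.omega_ne_zero (congrArg Subtype.val h)
  obtain ⟨c, hc⟩ := (finrank_eq_one_iff_of_nonzero' _ hω).1 hfin ⟨_, hmem⟩
  exact ⟨c, by simpa using (congrArg Subtype.val hc).symm⟩

/-! ## §3 The endomorphism `A = φ_a(Π ·) e_b + φ_b(Π ·) (r e_a)` and its complexification -/

/-- Squares of the period normalisations: `i^{n+1} · i^{n+1} = -(-1)ⁿ`. [folklore] -/
theorem I_pow_succ_mul_self (n : ℕ) : Complex.I ^ (n + 1) * Complex.I ^ (n + 1) = -(-1 : ℂ) ^ n := by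
  rw [← pow_add, show n + 1 + (n + 1) = 2 * (n + 1) by ring, pow_mul, Complex.I_sq]
  ring

/-- **The main theorem** (stub C for one realisation): if every endomorphism of Hodge structures of `H^{k-1}(W(ℂ); ℚ)`
compressed to `V_f` is a rational scalar (compression = `x ↦ Π_f (A x)` on `V_f`), `K_f = ℚ`, and `f` is real on the
imaginary axis, then `(s_a/s_b)²` is irrational for all critical `a, b` of opposite parity with `s_a s_b ≠ 0`.
[cite: DeningerScholl1991, Thm. 5.2 and Remark (2)] [cite: PasolPopa2013, Prop. 5.11] [cite: Shimura1977, §1] -/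
theorem irrational_periodRatio_sq_of_hodgeEndScalar (hK : coeffField f = ⊥)
    (hreal : ∀ t : ℝ, 0 < t → (f (UpperHalfPlane.ofComplex ((t : ℂ) * Complex.I))).im = 0)
    (hEnd : ∀ A : HodgeStructure.Hom D.hodge D.hodge, ∃ c : ℚ,
      (D.proj.toLinearMap ∘ₗ A.toLinearMap).restrict
          (fun x _ => LinearMap.mem_range_self D.proj.toLinearMap (A.toLinearMap x)) =
        c • (LinearMap.id : D.carrier →ₗ[ℚ] D.carrier))
    (a b : ℕ) (ha : (a : ℤ) + 2 ≤ k) (hb : (b : ℤ) + 2 ≤ k) (hab : Odd (a + b))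
    (hSa : (∫ t in Set.Ioi (0:ℝ), t ^ a * (f (UpperHalfPlane.ofComplex ((t : ℂ) * Complex.I))).re) ≠ 0)
    (hSb : (∫ t in Set.Ioi (0:ℝ), t ^ b * (f (UpperHalfPlane.ofComplex ((t : ℂ) * Complex.I))).re) ≠ 0) :
    Irrational (((∫ t in Set.Ioi (0:ℝ), t ^ a * (f (UpperHalfPlane.ofComplex ((t : ℂ) * Complex.I))).re) /
      (∫ t in Set.Ioi (0:ℝ), t ^ b * (f (UpperHalfPlane.ofComplex ((t : ℂ) * Complex.I))).re)) ^ 2) := by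
  -- notation
  set Sa : ℝ := ∫ t in Set.Ioi (0:ℝ), t ^ a * (f (UpperHalfPlane.ofComplex ((t : ℂ) * Complex.I))).re with hSa_def
  set Sb : ℝ := ∫ t in Set.Ioi (0:ℝ), t ^ b * (f (UpperHalfPlane.ofComplex ((t : ℂ) * Complex.I))).re with hSb_def
  rintro ⟨q, hq⟩
  -- the two period functionals
  obtain ⟨φa, hφaω, hφaF⟩ := D.period a ha
  obtain ⟨φb, hφbω, hφbF⟩ := D.period b hb
  set α : ℂ := Complex.I ^ (a + 1) * (Sa : ℂ) with hαdef
  set β : ℂ := Complex.I ^ (b + 1) * (Sb : ℂ) with hβdef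
  have hαω : Module.Dual.baseChange ℂ φa D.omega = α := by
    rw [hφaω, imagAxisPeriod_eq_of_im_eq_zero _ a hreal]
  have hβω : Module.Dual.baseChange ℂ φb D.omega = β := by
    rw [hφbω, imagAxisPeriod_eq_of_im_eq_zero _ b hreal]
  have hI0 : ∀ n : ℕ, Complex.I ^ (n + 1) ≠ 0 := fun n ↦ pow_ne_zero _ Complex.I_ne_zero
  have hα0 : α ≠ 0 := mul_ne_zero (hI0 a) (by exact_mod_cast hSa)
  have hβ0 : β ≠ 0 := mul_ne_zero (hI0 b) (by exact_mod_cast hSb)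
  -- parities: `(-1)^b = -(-1)^a`
  have hsgn : ((-1 : ℚ) ^ b) = -((-1 : ℚ) ^ a) := by
    have h1 : ((-1 : ℚ) ^ a) * (-1) ^ b = -1 := by rw [← pow_add]; exact hab.neg_one_pow
    have h2 : ((-1 : ℚ) ^ a) * (-1) ^ a = 1 := by rw [← pow_add, ← two_mul, pow_mul]; simp
    linear_combination ((-1 : ℚ) ^ a) * h1 - ((-1 : ℚ) ^ b) * h2
  have hεsq : ((-1 : ℚ) ^ a) * (-1) ^ a = 1 := by rw [← pow_add, ← two_mul, pow_mul]; simp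
  have hφbF' : φb ∘ₗ frobInfty D.W (k - 1).toNat = (-((-1 : ℚ) ^ a)) • φb := by rw [hφbF, hsgn]
  have hφaF' : φa ∘ₗ frobInfty D.W (k - 1).toNat = (-((-1 : ℚ) ^ b)) • φa := by rw [hφaF, hsgn, neg_neg]
  have hεsq' : ((-1 : ℚ) ^ b) * (-1) ^ b = 1 := by rw [hsgn]; simpa using hεsq
  -- the functionals do not vanish on `V_f`
  have hPω : D.proj.toLinearMap.baseChange ℂ D.omega = D.omega := D.proj_baseChange_omega
  have hne_a : φa ∘ₗ D.proj.toLinearMap ≠ 0 := by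
    intro h0
    have h := congrArg (fun ψ : Module.Dual ℚ _ ↦ Module.Dual.baseChange ℂ ψ D.omega) h0
    simp only [dual_baseChange_comp, LinearMap.comp_apply, hPω, hαω, map_zero, LinearMap.zero_apply] at h
    exact hα0 h
  have hne_b : φb ∘ₗ D.proj.toLinearMap ≠ 0 := by
    intro h0
    have h := congrArg (fun ψ : Module.Dual ℚ _ ↦ Module.Dual.baseChange ℂ ψ D.omega) h0
    simp only [dual_baseChange_comp, LinearMap.comp_apply, hPω, hβω, map_zero, LinearMap.zero_apply] at h
    exact hβ0 h
  -- the dual basis `e_a, e_b` of `V_f`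
  obtain ⟨ea, hea, haa, hab0⟩ := exists_mem_carrier_dual_eq_one_eq_zero D hεsq hφaF hφbF' hne_a
  obtain ⟨eb, heb, hbb, hba0⟩ := exists_mem_carrier_dual_eq_one_eq_zero D hεsq' hφbF hφaF' hne_b
  have hspan := carrier_le_span_pair D hK hea heb haa hab0 hba0 hbb
  -- `D.omega = α e_a + β e_b` in `V_{f,ℂ}`
  set ea' : ℂ ⊗[ℚ] bettiCohomology D.W (k - 1).toNat := (1 : ℂ) ⊗ₜ[ℚ] ea with hea'
  set eb' : ℂ ⊗[ℚ] bettiCohomology D.W (k - 1).toNat := (1 : ℂ) ⊗ₜ[ℚ] eb with heb'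
  have hωmem : D.omega ∈ Submodule.span ℂ {ea', eb'} := by
    rw [← hPω]; exact proj_baseChange_mem_span_pair D hspan D.omega
  obtain ⟨α', β', hωeq⟩ := Submodule.mem_span_pair.1 hωmem
  have hφa_ea' : Module.Dual.baseChange ℂ φa ea' = 1 := by rw [hea', dual_baseChange_one_tmul, haa]; norm_num
  have hφa_eb' : Module.Dual.baseChange ℂ φa eb' = 0 := by rw [heb', dual_baseChange_one_tmul, hba0]; norm_num
  have hφb_ea' : Module.Dual.baseChange ℂ φb ea' = 0 := by rw [hea', dual_baseChange_one_tmul, hab0]; norm_num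
  have hφb_eb' : Module.Dual.baseChange ℂ φb eb' = 1 := by rw [heb', dual_baseChange_one_tmul, hbb]; norm_num
  have hα' : α' = α := by
    have h := congrArg (Module.Dual.baseChange ℂ φa) hωeq
    rw [map_add, map_smul, map_smul, hφa_ea', hφa_eb', hαω, smul_eq_mul, smul_eq_mul, mul_one, mul_zero,
      add_zero] at h
    exact h
  have hβ' : β' = β := by
    have h := congrArg (Module.Dual.baseChange ℂ φb) hωeq
    rw [map_add, map_smul, map_smul, hφb_ea', hφb_eb', hβω, smul_eq_mul, smul_eq_mul, mul_zero, mul_one,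
      zero_add] at h
    exact h
  rw [hα', hβ'] at hωeq
  -- the rational number `r = α²/β² = -q`
  set r : ℚ := -q with hrdef
  have hqC : ((q : ℝ) : ℂ) = ((Sa / Sb) ^ 2 : ℝ) := by rw [hq]
  have hkey : ((r : ℚ) : ℂ) * (β * β) = α * α := by
    have hSb' : (Sb : ℂ) ≠ 0 := by exact_mod_cast hSb
    have hsgnC : ((-1 : ℂ) ^ b) = -((-1 : ℂ) ^ a) := by exact_mod_cast congrArg (fun x : ℚ ↦ (x : ℂ)) hsgn
    have hq' : ((q : ℚ) : ℂ) * ((Sb : ℂ) * Sb) = (Sa : ℂ) * Sa := by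
      have h : ((q : ℚ) : ℂ) = ((q : ℝ) : ℂ) := (Complex.ofReal_ratCast q).symm
      rw [h, hqC]; push_cast; field_simp
    have hr : ((r : ℚ) : ℂ) = -((q : ℚ) : ℂ) := by rw [hrdef]; push_cast; ring
    rw [hr, hαdef, hβdef]
    linear_combination (-((q : ℚ) : ℂ) * ((Sb : ℂ) * Sb)) * I_pow_succ_mul_self b
      + (-((Sa : ℂ) * Sa)) * I_pow_succ_mul_self a + ((-1 : ℂ) ^ b) * hq' + ((Sa : ℂ) * Sa) * hsgnC
  -- the endomorphism
  set A₁ : bettiCohomology D.W (k - 1).toNat →ₗ[ℚ] bettiCohomology D.W (k - 1).toNat :=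
    φa.smulRight eb + φb.smulRight (r • ea) with hA₁
  set A₀ : bettiCohomology D.W (k - 1).toNat →ₗ[ℚ] bettiCohomology D.W (k - 1).toNat := A₁ ∘ₗ D.proj.toLinearMap with hA₀
  have hA₁ℂ : ∀ x, A₁.baseChange ℂ x =
      Module.Dual.baseChange ℂ φa x • eb' + Module.Dual.baseChange ℂ φb x • ((r : ℂ) • ea') := by
    intro x
    rw [hA₁, LinearMap.baseChange_add, LinearMap.add_apply, baseChange_smulRight_apply, baseChange_smulRight_apply,
      heb', hea', TensorProduct.tmul_smul, Rat.cast_smul_eq_qsmul]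
  -- its value on `D.omega`: `A₁ D.omega = (α/β) D.omega`
  have hA₁ω : A₁.baseChange ℂ D.omega = (α / β) • D.omega := by
    rw [hA₁ℂ, hαω, hβω, ← hωeq, smul_add, smul_smul, smul_smul, smul_smul]
    have h1 : β * (r : ℂ) = α / β * α := by
      field_simp
      linear_combination hkey
    have h2 : α / β * β = α := div_mul_cancel₀ α hβ0
    rw [h1, h2, add_comm]
  -- `A₀` respects the Hodge filtration
  have hF : ∀ p, (D.hodge.F p).map (A₀.baseChange ℂ) ≤ D.hodge.F p := by
    intro p
    rintro _ ⟨x, hx, rfl⟩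
    rw [hA₀, LinearMap.baseChange_comp, LinearMap.comp_apply]
    rcases lt_or_ge p 1 with hp | hp
    · -- `p ≤ 0`: `F p = ⊤`
      have htop : D.hodge.F p = ⊤ := eq_top_iff.2 (D.F_zero ▸ D.hodge.antitone_F (by omega))
      rw [htop]; trivial
    rcases lt_or_ge p k with hpk | hpk
    · -- `1 ≤ p ≤ k - 1`: through the Eichler–Shimura line
      obtain ⟨c, hc⟩ := exists_proj_baseChange_eq_smul_omega D hK hp hx
      rw [hc, map_smul, hA₁ω, smul_smul]
      exact Submodule.smul_mem _ _ (D.hodge.antitone_F (show p ≤ k - 1 by omega) D.omega_mem_F)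
    · -- `k ≤ p`: `F p = ⊥`
      have hbot : x = 0 := by
        have h : x ∈ D.hodge.F k := D.hodge.antitone_F hpk hx
        rw [D.F_weight_add_one] at h
        exact (Submodule.mem_bot ℂ).1 h
      rw [hbot, map_zero, map_zero]
      exact Submodule.zero_mem _
  -- compress and conclude
  obtain ⟨c, hc⟩ := hEnd ⟨A₀, hF⟩
  have hval := congrArg (fun T : D.carrier →ₗ[ℚ] D.carrier ↦ ((T ⟨ea, hea⟩ : D.carrier) : bettiCohomology D.W (k - 1).toNat)) hc
  simp only [LinearMap.coe_restrict_apply, LinearMap.comp_apply, LinearMap.smul_apply, LinearMap.id_apply,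
    Submodule.coe_smul] at hval
  -- `Π (A₀ e_a) = e_b`
  have hA₀ea : A₀ ea = eb := by
    rw [hA₀, LinearMap.comp_apply, proj_apply_of_mem D hea, hA₁]
    simp [haa, hab0]
  rw [hA₀ea, proj_apply_of_mem D heb] at hval
  -- `e_b = c • e_a` contradicts `φ_b e_b = 1`, `φ_b e_a = 0`
  have h := congrArg φb hval
  rw [hbb, map_smul, hab0, smul_zero] at h
  exact one_ne_zero h

end Realisation

/-! ## §4 The stub, in the registered spelling -/

section Stub

/-- `compress D A` — the skeleton's compression `x ↦ Π_f (A x)` on `V_f` (display only; nothing is defined). -/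
local notation3 "compress " D:max A:max =>
  LinearMap.restrict (HodgeStructure.Hom.toLinearMap (SchollBettiRealisation.proj D) ∘ₗ A)
    (fun x _ => LinearMap.mem_range_self (HodgeStructure.Hom.toLinearMap (SchollBettiRealisation.proj D))
      ((A : _ →ₗ[ℚ] _) x))

/-- **Stub `stub_periodRatioSq_irrational_of_hodgeEndScalar` of crux `HodgeForcesNewformPeriodRatioIrrational` (registered
signature, verbatim in the skeleton's spelling): no extra Hodge endomorphisms on `V_f` ⟹ the cross-parity period ratio squared
is irrational.** [cite: DeningerScholl1991, Thm. 5.2 and Remark (2)] [cite: PasolPopa2013, Prop. 5.11] [cite: Shimura1977, §1] -/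
theorem stub_periodRatioSq_irrational_of_hodgeEndScalar :
    ∀ (N : ℕ) [NeZero N] (k : ℤ) (f : CuspForm (CongruenceSubgroup.Gamma0 N) k)
      (D : SchollBettiRealisation f),
      coeffField f = ⊥ →
      (∀ t : ℝ, 0 < t → (f (UpperHalfPlane.ofComplex ((t : ℂ) * Complex.I))).im = 0) →
      (∀ A : HodgeStructure.Hom D.hodge D.hodge, ∃ c : ℚ, compress D A.toLinearMap = c • LinearMap.id) →
      ∀ a b : ℕ, (a : ℤ) + 2 ≤ k → (b : ℤ) + 2 ≤ k → Odd (a + b) →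
        (∫ t in Set.Ioi (0:ℝ), t ^ a * (f (UpperHalfPlane.ofComplex ((t : ℂ) * Complex.I))).re) ≠ 0 →
        (∫ t in Set.Ioi (0:ℝ), t ^ b * (f (UpperHalfPlane.ofComplex ((t : ℂ) * Complex.I))).re) ≠ 0 →
        Irrational (((∫ t in Set.Ioi (0:ℝ), t ^ a * (f (UpperHalfPlane.ofComplex ((t : ℂ) * Complex.I))).re) /
          (∫ t in Set.Ioi (0:ℝ), t ^ b * (f (UpperHalfPlane.ofComplex ((t : ℂ) * Complex.I))).re)) ^ 2) :=
  fun _ _ _ _ D hK hreal hEnd a b ha hb hab hSa hSb ↦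
    irrational_periodRatio_sq_of_hodgeEndScalar D hK hreal hEnd a b ha hb hab hSa hSb

end Stub

end Summit.HodgeConjecture.HodgeConjecture.Theorems.HodgeForcesNewformPeriodRatioIrrational

end
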